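import Summits.Ventures.HodgeRepro2.T5SU11JacobiPhaseTailXi
import Summits.Ventures.HodgeRepro2.T5SU11JacobiOrbitMoments
import Summits.Ventures.HodgeRepro2.T5SU11JacobiThreeFour

/-!
# The weight-`3` dossier, III: the law of the phase and of the orbit radius at the owner's weight `k = 3`

The third dossier specialises the probabilistic chapter (`T5SU11JacobiPhaseTailGroup` …
`T5SU11JacobiPhaseTailXi`) to `k = 3`, on the strip `−1 < λ < 3`, for the probability measure
`m_3 φ_λ dν / m̂_3(λ)` of the explicit model `π₃⁺`:

* the tail of the phase, `P_{3,λ}(log|a| > t) = 2π ∫_t^∞ e^{−s} Φ_λ(s) ds / m̂_3(λ)` (`phase_tail_three`),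
  with `m̂_3(λ) = 2π(1 − λ)/cos(πλ/2)` for `λ ≠ 1` (`phase_tail_three_closed`);
* the mean squared orbit radius `E_{3,λ}[|g·0|²] = (6 − 2λ + λ²)/9` (`mean_orbit_sq_three`), its variance
  `r_3(λ)(r_5(λ) − r_3(λ))` with `r_3 = (3−λ)(1+λ)/9`, `r_5 = (5−λ)(3+λ)/25` (`variance_orbit_sq_three`),
  and every moment `E_{3,λ}[|g·0|^{2n}] = ∑_j (−1)^j C(n, j) ∏_{i<j} r_{3+2i}(λ)` (`moment_orbit_sq_three`);
* the large-deviation rate `1 + λ` of the phase for `−1 < λ < 1`: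
  `e^{(1+λ)x} P_{3,λ}(log|a| > x) → c(λ) 2^{−λ} cos(πλ/2)/((1 + λ)(1 − λ))` (`tendsto_exp_mul_tail_prob_three`),
  the rate `3 − λ` for `1 < λ < 3` (`tendsto_exp_mul_tail_three'`), and at `λ = 1` the order `x e^{−2x}`
  (`T5SU11JacobiPhaseTailXi.tail_xi_three_le/ge`).

Nothing is claimed about (N).

Blind lane: Mathlib + the HodgeRepro2 prefix only; no sorry; axioms ⊆ {propext, Classical.choice,
Quot.sound}.
-/

namespace Summit.Ventures.HodgeRepro2.T5SU11WeightThreeDossierIII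

open MeasureTheory MeasureTheory.Measure Metric Set Filter Topology Finset
open T5SU11Unimodular T5SU11Fibration T5SU11Cartan T5SU11OneParameter T5SU11CartanProjection T5HaarCircle
  T5BergmanCoefficient T5SU11FibrationHaar T5SU11SphericalFunction T5SU11SphericalSymmetry
  T5SU11SphericalBounds T5SU11SphericalContinuous T5SU11JacobiIwasawa T5SU11JacobiTransform
  T5SU11JacobiWeight T5SU11KFiniteMajorantPow T5SU11JacobiDuplication T5SU11JacobiLaplacePhase
  T5SU11JacobiWeightRecursion T5SU11JacobiPhaseTailGroup T5SU11JacobiPhaseMGF T5SU11JacobiOrbitMoments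
  T5SU11JacobiPhaseTailRate T5SU11JacobiThreeFour T5SU11SphericalAsymptotic
open scoped Real

/-- `r_3(λ) = (3 − λ)(1 + λ)/9`. -/
theorem weightRatio_three' (lam : ℝ) : weightRatio 3 lam = (3 - lam) * (1 + lam) / 9 := by
  unfold weightRatio
  ring

/-- `r_5(λ) = (5 − λ)(3 + λ)/25`. -/
theorem weightRatio_five (lam : ℝ) : weightRatio 5 lam = (5 - lam) * (3 + lam) / 25 := by
  unfold weightRatio
  ring

section measure

variable [MeasurableSpace Circle] [BorelSpace Circle]

/-! ### The tail of the phase at `k = 3` -/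

/-- **The tail of the phase at `k = 3`**: for `−1 < λ < 3` and `t ≥ 0`,
`∫_{t < log|a|} m_3 φ_λ dν = 2π ∫_t^∞ e^{−s} Φ_λ(s) ds`. -/
theorem phase_tail_three {lam : ℝ} (h1 : -1 < lam) (h2 : lam < 3) {t : ℝ} (ht : 0 ≤ t) :
    ∫ g in {g : SU11 | t < Real.log ‖mat g 0 0‖},
        (1 - ‖orbit g‖ ^ 2) ^ ((3 : ℝ) / 2) * sph lam g ∂(nu haarCircle)
      = 2 * π * ∫ s in Ioi t, Real.exp (-s) * sphPhase lam s := by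
  rw [integral_phase_tail_eq (by norm_num) h2 (by linarith) ht]
  congr 1
  refine setIntegral_congr_fun measurableSet_Ioi fun s _ => ?_
  rw [show -(((3 : ℝ) - 2) * s) = -s by ring]

/-- **The tail probability at `k = 3` in closed form**: for `−1 < λ < 3`, `λ ≠ 1`, `t ≥ 0`,
`P_{3,λ}(log|a| > t) = cos(πλ/2) ∫_t^∞ e^{−s} Φ_λ(s) ds / (1 − λ)`. -/
theorem phase_tail_three_closed {lam : ℝ} (h1 : -1 < lam) (h2 : lam < 3) (h3 : lam ≠ 1) {t : ℝ}
    (ht : 0 ≤ t) :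
    (∫ g in {g : SU11 | t < Real.log ‖mat g 0 0‖},
        (1 - ‖orbit g‖ ^ 2) ^ ((3 : ℝ) / 2) * sph lam g ∂(nu haarCircle))
      / ∫ g, (1 - ‖orbit g‖ ^ 2) ^ ((3 : ℝ) / 2) * sph lam g ∂(nu haarCircle)
      = Real.cos (π * lam / 2) * (∫ s in Ioi t, Real.exp (-s) * sphPhase lam s) / (1 - lam) := by
  rw [phase_tail_three h1 h2 ht, integral_orbit_rpow_three_mul_sph h1 h2 h3]
  have hpi : (2 * π : ℝ) ≠ 0 := by positivity
  have hl : (1 : ℝ) - lam ≠ 0 := sub_ne_zero.mpr (Ne.symm h3)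
  have hc : Real.cos (π * lam / 2) ≠ 0 := by
    intro hc0
    have hm := jacobi_pos (k := 3) (lam := lam) (by norm_num) h2 (by linarith)
    rw [integral_orbit_rpow_three_mul_sph h1 h2 h3, hc0, div_zero] at hm
    exact lt_irrefl _ hm
  field_simp

/-! ### The orbit radius at `k = 3` -/

/-- **`E_{3,λ}[|g·0|²] = (6 − 2λ + λ²)/9`** on `−1 < λ < 3`. -/
theorem mean_orbit_sq_three {lam : ℝ} (h1 : -1 < lam) (h2 : lam < 3) :
    (∫ g, ‖orbit g‖ ^ 2 * ((1 - ‖orbit g‖ ^ 2) ^ ((3 : ℝ) / 2) * sph lam g) ∂(nu haarCircle))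
        / ∫ g, (1 - ‖orbit g‖ ^ 2) ^ ((3 : ℝ) / 2) * sph lam g ∂(nu haarCircle)
      = (6 - 2 * lam + lam ^ 2) / 9 := by
  rw [mean_orbit_sq_eq' (by norm_num) h2 (by linarith)]
  ring

/-- **`Var_{3,λ}(|g·0|²) = r_3(λ)(r_5(λ) − r_3(λ))`** on `−1 < λ < 3`, with
`r_3 = (3 − λ)(1 + λ)/9`, `r_5 = (5 − λ)(3 + λ)/25`. -/
theorem variance_orbit_sq_three {lam : ℝ} (h1 : -1 < lam) (h2 : lam < 3) :
    (∫ g, (‖orbit g‖ ^ 2) ^ 2 * ((1 - ‖orbit g‖ ^ 2) ^ ((3 : ℝ) / 2) * sph lam g) ∂(nu haarCircle))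
          / (∫ g, (1 - ‖orbit g‖ ^ 2) ^ ((3 : ℝ) / 2) * sph lam g ∂(nu haarCircle))
        - ((∫ g, ‖orbit g‖ ^ 2 * ((1 - ‖orbit g‖ ^ 2) ^ ((3 : ℝ) / 2) * sph lam g) ∂(nu haarCircle))
          / (∫ g, (1 - ‖orbit g‖ ^ 2) ^ ((3 : ℝ) / 2) * sph lam g ∂(nu haarCircle))) ^ 2
      = (3 - lam) * (1 + lam) / 9 * ((5 - lam) * (3 + lam) / 25 - (3 - lam) * (1 + lam) / 9) := by
  rw [variance_orbit_sq_eq (by norm_num) h2 (by linarith), weightRatio_three',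
    show (3 : ℝ) + 2 = 5 by norm_num, weightRatio_five]

/-- **Every moment of the orbit radius at `k = 3`**:
`E_{3,λ}[|g·0|^{2n}] = ∑_{j ≤ n} (−1)^j C(n, j) ∏_{i<j} r_{3+2i}(λ)` on `−1 < λ < 3`. -/
theorem moment_orbit_sq_three {lam : ℝ} (h1 : -1 < lam) (h2 : lam < 3) (n : ℕ) :
    (∫ g, (‖orbit g‖ ^ 2) ^ n * ((1 - ‖orbit g‖ ^ 2) ^ ((3 : ℝ) / 2) * sph lam g) ∂(nu haarCircle))
        / ∫ g, (1 - ‖orbit g‖ ^ 2) ^ ((3 : ℝ) / 2) * sph lam g ∂(nu haarCircle)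
      = ∑ j ∈ range (n + 1), (-1 : ℝ) ^ j * (n.choose j : ℝ)
          * ∏ i ∈ range j, weightRatio (3 + 2 * i) lam :=
  moment_orbit_sq_eq_sum_prod (by norm_num) h2 (by linarith) n

/-! ### The large-deviation rates at `k = 3` -/

/-- **The rate `1 + λ` at `k = 3`** for `−1 < λ < 1`:
`e^{(1+λ)x} P_{3,λ}(log|a| > x) → c(λ) 2^{−λ} cos(πλ/2)/((1 + λ)(1 − λ))`. -/
theorem tendsto_exp_mul_tail_prob_three {lam : ℝ} (h1 : -1 < lam) (hlam : lam < 1) :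
    Tendsto (fun x : ℝ => Real.exp ((1 + lam) * x)
        * ((∫ g in {g : SU11 | x < Real.log ‖mat g 0 0‖},
            (1 - ‖orbit g‖ ^ 2) ^ ((3 : ℝ) / 2) * sph lam g ∂(nu haarCircle))
          / ∫ g, (1 - ‖orbit g‖ ^ 2) ^ ((3 : ℝ) / 2) * sph lam g ∂(nu haarCircle))) atTop
      (𝓝 (cfun lam * Real.exp (-(lam * Real.log 2)) * Real.cos (π * lam / 2)
        / ((1 + lam) * (1 - lam)))) := by
  have h := tendsto_exp_mul_tail_prob (k := 3) (lam := lam) (by norm_num) (by linarith) (by linarith) hlam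
  rw [show (3 : ℝ) - 2 + lam = 1 + lam by ring] at h
  have hpi : (2 * π : ℝ) ≠ 0 := by positivity
  have hl : (1 : ℝ) - lam ≠ 0 := by linarith
  have hl' : (1 : ℝ) + lam ≠ 0 := by linarith
  have hc : Real.cos (π * lam / 2) ≠ 0 := by
    intro hc0
    have hm := jacobi_pos (k := 3) (lam := lam) (by norm_num) (by linarith) (by linarith)
    rw [integral_orbit_rpow_three_mul_sph h1 (by linarith) (by linarith), hc0, div_zero] at hm
    exact lt_irrefl _ hm
  convert h using 2
  rw [integral_orbit_rpow_three_mul_sph h1 (by linarith) (by linarith)]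
  field_simp

/-- **The rate `3 − λ` at `k = 3`** for `1 < λ < 3`:
`e^{(3−λ)x} ∫_x^∞ e^{−s} Φ_λ(s) ds → c(2 − λ) 2^{−(2−λ)}/(3 − λ)`. -/
theorem tendsto_exp_mul_tail_three' {lam : ℝ} (h2 : lam < 3) (hlam : 1 < lam) :
    Tendsto (fun x : ℝ => Real.exp ((3 - lam) * x) * ∫ s in Ioi x, Real.exp (-s) * sphPhase lam s) atTop
      (𝓝 (cfun (2 - lam) * Real.exp (-((2 - lam) * Real.log 2)) / (3 - lam))) := by
  have h := tendsto_exp_mul_tail' (k := 3) h2 hlam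
  refine h.congr' (Filter.Eventually.of_forall fun x => ?_)
  congr 1
  refine setIntegral_congr_fun measurableSet_Ioi fun s _ => ?_
  rw [show -(((3 : ℝ) - 2) * s) = -s by ring]

end measure

end Summit.Ventures.HodgeRepro2.T5SU11WeightThreeDossierIII
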